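import Summits.AtomisticToContinuum.BoseEinsteinCondensation.Theorems.BECLatticeDepthHomotopyModeIdentificationBounded
import HarnessLib

/-!
# Route `BECLatticeDepthHomotopy`, support item `ModeIdentification` (stmt-AtomisticToContinuum-12408):
# the trivial direction and the resulting EQUALITY of the two ground-state condensate numbers

Helper file (supports, does not close, stmt-AtomisticToContinuum-12408). The constant mode
`L^{-3/2} 1_cell` is one of the normalised modes entering `λ_max(γ_Ψ) = maxOccupation N (1_{cell^N} Ψ)`,
so `⟨Ψ, n₀ Ψ⟩ ≤ λ_max(γ_Ψ)` pointwise (`condensateOccupation_le_maxOccupation_indicator`) and, by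
monotonicity of `sup_δ inf`, `periodicCondensateNumber v N L ≤ Λ(0)` for every `v, N, L > 0`
(`periodicCondensateNumber_le_iSup_iInf_maxOccupation`). With the non-trivial direction of
`BECLatticeDepthHomotopyModeIdentificationBounded.lean` this identifies the two numbers for bounded
potentials: `Λ(0) = periodicCondensateNumber v N L` for `v ≤ M < ∞`, all `N ≥ 1`, `L > 0`
(`iSup_iInf_maxOccupation_eq_periodicCondensateNumber`).

References: E. H. Lieb, R. Seiringer, J. P. Solovej, J. Yngvason (2005), §1.2 (1.17)–(1.19) [LSSY2005].
-/

noncomputable section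

namespace Summit.AtomisticToContinuum.BoseEinsteinCondensation.Theorems.ModeIdentification

open MeasureTheory Filter
open scoped ENNReal NNReal Topology
open Literature.MathematicalPhysics.QuantumManyBody.BoseGas
open Literature.Barriers.AtomisticToContinuum.BoseGas (periodicCondensateNumber)

variable {N : ℕ} {L : ℝ}

/-- **`n₀ ≤ λ_max`**: the constant-mode occupation of a state on the cell is one of the occupations
entering the mode-free `λ_max(γ_Ψ) = maxOccupation N (1_{cell^N} Ψ)` (`L > 0`). [cite: LSSY2005, §1.2 (1.17)–(1.18)] -/
theorem condensateOccupation_le_maxOccupation_indicator (hL : 0 < L) (Ψ : Config N → ℂ) :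
    condensateOccupation N L Ψ ≤ maxOccupation N ((cellN N L).indicator Ψ) := by
  refine occupation_le_maxOccupation _ (aestronglyMeasurable_const.indicator (measurableSet_cell L)) ?_
  -- the constant mode is normalised: `∫ |L^{-3/2} 1_cell|² = L⁻³ |cell| = 1`
  -- (cf. `lintegral_constantMode_sq` of BoseGasCatStates.lean, not imported to keep the closure small)
  have hpt : ∀ x, (‖constantMode L x‖₊ : ℝ≥0∞) ^ 2 =
      (cell L).indicator (fun _ => (ENNReal.ofReal L ^ 3)⁻¹) x := by
    intro x
    unfold constantMode
    by_cases hx : x ∈ cell L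
    · rw [Set.indicator_of_mem hx, Set.indicator_of_mem hx, nnnorm_constantMode_sq hL]
    · rw [Set.indicator_of_notMem hx, Set.indicator_of_notMem hx]
      simp
  simp_rw [hpt]
  rw [lintegral_indicator (measurableSet_cell L), setLIntegral_const, volume_cell,
    ENNReal.inv_mul_cancel (pow_ne_zero _ (by simpa using hL)) (ENNReal.pow_ne_top ENNReal.ofReal_ne_top)]

/-- **The trivial direction of the mode identification**: for every `v`, `N` and `L > 0`,
`periodicCondensateNumber v N L ≤ sup_{δ>0} inf_{𝓔[Ψ] ≤ E₀+δ} λ_max(γ_Ψ)` (monotonicity of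
`sup inf` under the pointwise `n₀ ≤ λ_max`). [cite: LSSY2005, §1.2 (1.17)–(1.19)] -/
theorem periodicCondensateNumber_le_iSup_iInf_maxOccupation (v : ℝ → ℝ≥0∞) (N : ℕ) (hL : 0 < L) :
    periodicCondensateNumber v N L ≤
      ⨆ (δ : ℝ≥0∞) (_ : 0 < δ), ⨅ (Ψ : PeriodicTrialState N L)
        (_ : periodicEnergy v Ψ ≤ periodicGroundStateEnergy v N L + δ),
          maxOccupation N ((cellN N L).indicator Ψ.ψ) :=
  iSup₂_mono fun _ _ => iInf₂_mono fun Ψ _ => condensateOccupation_le_maxOccupation_indicator hL Ψ.ψ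

/-- **Mode identification for bounded potentials, as an equality**: for `v` repulsive finite-range
with `v ≤ M < ∞`, `N = n + 1 ≥ 1`, `L > 0`, the mode-free and the constant-mode ground-state condensate
numbers coincide, `sup_{δ>0} inf_{𝓔[Ψ] ≤ E₀+δ} λ_max(γ_Ψ) = periodicCondensateNumber v (n+1) L`.
[cite: LSSY2005, §1.2 (1.17)–(1.19)] -/
theorem iSup_iInf_maxOccupation_eq_periodicCondensateNumber {v : ℝ → ℝ≥0∞}
    (hv : IsRepulsiveFiniteRange v) (hM : ∃ M : ℝ≥0∞, M ≠ ⊤ ∧ ∀ r, v r ≤ M) (n : ℕ) (hL : 0 < L) :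
    (⨆ (δ : ℝ≥0∞) (_ : 0 < δ), ⨅ (Ψ : PeriodicTrialState (n + 1) L)
      (_ : periodicEnergy v Ψ ≤ periodicGroundStateEnergy v (n + 1) L + δ),
        maxOccupation (n + 1) ((cellN (n + 1) L).indicator Ψ.ψ)) =
      periodicCondensateNumber v (n + 1) L :=
  le_antisymm (iSup_iInf_maxOccupation_le_periodicCondensateNumber hv hM n hL)
    (periodicCondensateNumber_le_iSup_iInf_maxOccupation v (n + 1) hL)

end Summit.AtomisticToContinuum.BoseEinsteinCondensation.Theorems.ModeIdentification

end
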